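import Summits.QuantumFields.YangMills.Theorems.FemtoCutoffLadderFixedLatticeLawOffTubeKernel
import HarnessLib

/-!
# Crux `FixedLatticeLaw` (stmt-QuantumFields-23943 ≡ leaf `FemtoGapFixedLattice`), flat-tube split — the RE-ORTHOGONALISED TUBE TRUNCATION
# (the Hilbert-space step of K2 = `FlatTubeReduction.OffTubeSuppression`, stmt-QuantumFields-24721)

Seat `ym-line-fcl-p3` g2 (2026-08-28; explicit-unit prover of route `FemtoCutoffLadder`).  Rung R2b1 = RECORD-label femto transfer gap: NOT infinite
volume, NOT the Clay mass gap, no summit.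

★ `reorthogonalise` — a pure min–max / Cauchy–Schwarz lemma at a threshold `η` with two smallness parameters `t ≤ 1/2` (tail) and `δ` (kernel):
if the exact physical eigenvector `K_βΩ = λ₀Ω` has off-tube mass `‖1_{η<S}Ω‖² ≤ t‖Ω‖²`, and `|⟨f, K_βφ⟩| ≤ δλ₀(‖f‖² + ‖φ‖²)/2` whenever the physical
`φ` vanishes on `{S ≤ η}`, then every physical `ψ ⊥ Ω` admits the TUBE-SUPPORTED physical `ψ' := 1_{S≤η}ψ − a·1_{S≤η}Ω ⊥ Ω`,
`a = ⟨1_{S≤η}ψ, Ω⟩/‖1_{S≤η}Ω‖²`, with `‖ψ'‖² = ‖1_{S≤η}ψ‖² − a²‖1_{S≤η}Ω‖² ≤ ‖ψ‖²` and `⟨ψ,K_βψ⟩ ≤ ⟨ψ',K_βψ'⟩ + 4(δ + t)·λ₀‖ψ‖²`.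
Bookkeeping: `m := ⟨1_{S≤η}ψ, Ω⟩ = −⟨1_{η<S}ψ, 1_{η<S}Ω⟩`, so `m² ≤ 2t·n·‖ψ‖²` (`n = ‖1_{S≤η}Ω‖² ≥ ‖Ω‖²/2`), `a²n ≤ 2t‖ψ‖²`, `a²‖1_{η<S}Ω‖² ≤ ‖ψ‖²`;
the energy split `Q(ψ) = Q(ψ_T) + 2⟨ψ_T,Kψ_o⟩ + Q(ψ_o)`, `Q(ψ') ≥ Q(ψ_T) − 2a⟨ψ_T,KΩ_T⟩`, `⟨ψ_T,KΩ_T⟩ = λ₀m − ⟨ψ_T,KΩ_o⟩`.  The two real-number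
endgames are isolated as `reorth_norm_arith` / `reorth_energy_arith`.

HONEST FRAMING: Hilbert-space bookkeeping only; the smallness inputs (`t`, `δ` eventually `≤ λ_b³/(8L)`) are supplied by
`…FixedLatticeLawOffTubeKernel.lean` and RED's polynomial floor in the assembly file.  No definitions, no named facts, no `sorry`.
-/

set_option autoImplicit false

noncomputable section

open MeasureTheory Real
open Literature.MathematicalPhysics.QuantumFieldTheory hiding SU2
open Literature.MathematicalPhysics.QuantumLattice

namespace Summit.QuantumFields.YangMills.Theorems.FemtoCutoffLadder

open Summit.QuantumFields.YangMills.Theorems.FemtoTransferGap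

variable {L : ℕ} [NeZero L]

/-! ## §1 Right-slot bilinearity of the `SU(2)` transfer form (from symmetry) -/

/-- The transfer form is additive in its second argument (physical test functions). [folklore] -/
theorem qform_add_right (β : ℝ) {f g h : GaugeConfig 3 L SU2 → ℝ} (hf : IsPhys f) (hg : IsPhys g) (hh : IsPhys h) :
    qform su2Rep β f (g + h) = qform su2Rep β f g + qform su2Rep β f h := by
  rw [qform_su2Rep_comm β hf (hg.add hh), qform_add_left β hg hh hf, qform_su2Rep_comm β hg hf, qform_su2Rep_comm β hh hf]

/-- The transfer form is homogeneous in its second argument (physical test functions). [folklore] -/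
theorem qform_smul_right (β c : ℝ) {f g : GaugeConfig 3 L SU2 → ℝ} (hf : IsPhys f) (hg : IsPhys g) :
    qform su2Rep β f (c • g) = c * qform su2Rep β f g := by
  rw [qform_su2Rep_comm β hf (hg.smul c), qform_smul_left, qform_su2Rep_comm β hg hf]

/-! ## §2 The two real-number endgames -/

/-- Norm endgame: `nT − 2am + a²n ≤ N` from `a·m = a²n`, `a²n ≥ 0`… (here only `nT ≤ N` and `a m = a² n` are used). [folklore] -/
theorem reorth_norm_arith {nT N a m n : ℝ} (hnT : nT ≤ N) (ham : a * m = a ^ 2 * n) (hn : 0 ≤ n) :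
    nT - 2 * a * m + a ^ 2 * n ≤ N := by
  have h2 : 0 ≤ a ^ 2 * n := mul_nonneg (sq_nonneg a) hn
  nlinarith [hnT, ham, h2]

/-- Energy endgame: with `Y = lam·m − Z`, `a·m = a²n`, `lam·a²n ≤ 2t·lam·N`, `a²Q ≥ 0`, `X ≤ δ lam N/2`, `Qo ≤ δ lam N`, `−aZ ≤ δ lam N`:
`QT + 2X + Qo ≤ QT − 2aY + a²Q + 4(δ+t) lam N`. [folklore] -/
theorem reorth_energy_arith {QT X Qo Y Z Q N a m n lam δ t : ℝ}
    (hY : a * Y = lam * (a * m) - a * Z) (ham : lam * (a * m) = lam * (a ^ 2 * n))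
    (hF3 : lam * (a ^ 2 * n) ≤ lam * (2 * t * N)) (hQ : 0 ≤ a ^ 2 * Q)
    (hX : X ≤ δ * lam * N / 2) (hQo : Qo ≤ δ * lam * N) (hZ : -(a * Z) ≤ δ * lam * N) :
    QT + 2 * X + Qo ≤ QT - 2 * a * Y + a ^ 2 * Q + 4 * (δ + t) * lam * N := by
  nlinarith [hY, ham, hF3, hQ, hX, hQo, hZ]

/-! ## §3 The re-orthogonalised tube truncation -/

/-- ★ **Re-orthogonalised tube truncation.**  Let `β ≥ 0`, `0 ≤ t ≤ 1/2`, `0 ≤ δ`; `Ω` physical with `K_βΩ = λ₀Ω`, `ψ` physical with `⟨ψ,Ω⟩ = 0`;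
assume the tail bound `‖1_{η<S}Ω‖² ≤ t‖Ω‖²` and the off-tube kernel bound `|⟨f,K_βφ⟩| ≤ δλ₀(‖f‖² + ‖φ‖²)/2` for physical `f, φ` with `φ = 0`
on `{S ≤ η}`.  Then there is a physical `ψ' ⊥ Ω`, vanishing on `{η < S}`, with `‖ψ'‖² ≤ ‖ψ‖²` and `⟨ψ,K_βψ⟩ ≤ ⟨ψ',K_βψ'⟩ + 4(δ + t)λ₀‖ψ‖²`
(`ψ' = 1_{S≤η}ψ − a·1_{S≤η}Ω`). [cite: ReedSimonIV1978, Thm. XIII.1] -/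
theorem reorthogonalise {β η t δ : ℝ} (hβ : 0 ≤ β) (ht0 : 0 ≤ t) (ht : t ≤ 1 / 2) (hδ : 0 ≤ δ)
    {Ω ψ : GaugeConfig 3 L SU2 → ℝ} (hΩ : IsPhys Ω) (hψ : IsPhys ψ)
    (heig : transferApply β Ω = topValue su2Rep L β • Ω) (horth : l2 ψ Ω = 0)
    (htail : l2 (fun U => if η < wilsonAction su2Rep U then Ω U else 0) (fun U => if η < wilsonAction su2Rep U then Ω U else 0)
      ≤ t * l2 Ω Ω)
    (hker : ∀ f φ : GaugeConfig 3 L SU2 → ℝ, IsPhys f → IsPhys φ → (∀ U, φ U ≠ 0 → η < wilsonAction su2Rep U) →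
      |qform su2Rep β f φ| ≤ δ * topValue su2Rep L β * (l2 f f + l2 φ φ) / 2) :
    ∃ ψ' : GaugeConfig 3 L SU2 → ℝ, IsPhys ψ' ∧ l2 ψ' Ω = 0 ∧ (∀ U, η < wilsonAction su2Rep U → ψ' U = 0) ∧
      l2 ψ' ψ' ≤ l2 ψ ψ ∧
      qform su2Rep β ψ ψ ≤ qform su2Rep β ψ' ψ' + 4 * (δ + t) * topValue su2Rep L β * l2 ψ ψ := by
  -- the four cuts
  set ψT : GaugeConfig 3 L SU2 → ℝ := fun U => if η < wilsonAction su2Rep U then 0 else ψ U with hψT_def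
  set ψo : GaugeConfig 3 L SU2 → ℝ := fun U => if η < wilsonAction su2Rep U then ψ U else 0 with hψo_def
  set ΩT : GaugeConfig 3 L SU2 → ℝ := fun U => if η < wilsonAction su2Rep U then 0 else Ω U with hΩT_def
  set Ωo : GaugeConfig 3 L SU2 → ℝ := fun U => if η < wilsonAction su2Rep U then Ω U else 0 with hΩo_def
  have hψT : IsPhys ψT := isPhys_inCut η hψ
  have hψo : IsPhys ψo := isPhys_offCut η hψ
  have hΩT : IsPhys ΩT := isPhys_inCut η hΩ
  have hΩo : IsPhys Ωo := isPhys_offCut η hΩ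
  have hψo_s : ∀ U, ψo U ≠ 0 → η < wilsonAction su2Rep U := fun U hU => by
    by_contra h
    exact hU (by simp [hψo_def, h])
  have hΩo_s : ∀ U, Ωo U ≠ 0 → η < wilsonAction su2Rep U := fun U hU => by
    by_contra h
    exact hU (by simp [hΩo_def, h])
  have hsplitψ : ψT + ψo = ψ := by
    funext U
    simp only [Pi.add_apply, hψT_def, hψo_def]
    split_ifs <;> simp
  have hsplitΩ : ΩT + Ωo = Ω := by
    funext U
    simp only [Pi.add_apply, hΩT_def, hΩo_def]
    split_ifs <;> simp
  -- pointwise-product identities for `l2`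
  have e_ψTψ : l2 ψT ψ = l2 ψT ψT := l2_congr_mul fun U => by
    simp only [hψT_def]; split_ifs <;> simp
  have e_ψoψ : l2 ψo ψ = l2 ψo ψo := l2_congr_mul fun U => by
    simp only [hψo_def]; split_ifs <;> simp
  have e_ΩTΩ : l2 ΩT Ω = l2 ΩT ΩT := l2_congr_mul fun U => by
    simp only [hΩT_def]; split_ifs <;> simp
  have e_ΩoΩ : l2 Ωo Ω = l2 Ωo Ωo := l2_congr_mul fun U => by
    simp only [hΩo_def]; split_ifs <;> simp
  have e_ψoΩ : l2 ψo Ω = l2 ψo Ωo := l2_congr_mul fun U => by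
    simp only [hψo_def, hΩo_def]; split_ifs <;> simp
  have e_ψTΩT : l2 ψT ΩT = l2 ψT Ω := l2_congr_mul fun U => by
    simp only [hψT_def, hΩT_def]; split_ifs <;> simp
  -- norms
  have hnψ : l2 ψT ψT + l2 ψo ψo = l2 ψ ψ := by
    rw [← e_ψTψ, ← e_ψoψ, ← l2_add_left hψT hψo hψ, hsplitψ]
  have hnΩ : l2 ΩT ΩT + l2 Ωo Ωo = l2 Ω Ω := by
    rw [← e_ΩTΩ, ← e_ΩoΩ, ← l2_add_left hΩT hΩo hΩ, hsplitΩ]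
  have hnψT0 : 0 ≤ l2 ψT ψT := l2_self_nonneg _
  have hnψo0 : 0 ≤ l2 ψo ψo := l2_self_nonneg _
  have hn0 : 0 ≤ l2 ΩT ΩT := l2_self_nonneg _
  have hnΩo0 : 0 ≤ l2 Ωo Ωo := l2_self_nonneg _
  have hnΩ0 : 0 ≤ l2 Ω Ω := l2_self_nonneg _
  have hnψ0 : 0 ≤ l2 ψ ψ := l2_self_nonneg _
  have hnψT_le : l2 ψT ψT ≤ l2 ψ ψ := by linarith
  have hnψo_le : l2 ψo ψo ≤ l2 ψ ψ := by linarith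
  have hΩ_le : l2 Ω Ω ≤ 2 * l2 ΩT ΩT := by nlinarith [htail, hnΩ, ht, hnΩ0]
  -- the overlap `m = ⟨ψ_T, Ω⟩ = −⟨ψ_o, Ω_o⟩`
  have hm_eq : l2 ψT Ω = -l2 ψo Ωo := by
    have h1 : l2 ψT Ω + l2 ψo Ω = l2 ψ Ω := by rw [← l2_add_left hψT hψo hΩ, hsplitψ]
    rw [horth, e_ψoΩ] at h1
    linarith
  have hm_bd : l2 ψT Ω ^ 2 ≤ 2 * t * l2 ΩT ΩT * l2 ψ ψ := by
    have h2 : l2 Ωo Ωo ≤ t * (2 * l2 ΩT ΩT) := htail.trans (mul_le_mul_of_nonneg_left hΩ_le ht0)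
    calc l2 ψT Ω ^ 2 = l2 ψo Ωo ^ 2 := by rw [hm_eq, neg_sq]
      _ ≤ l2 ψo ψo * l2 Ωo Ωo := sq_l2_le hψo hΩo
      _ ≤ l2 ψ ψ * (t * (2 * l2 ΩT ΩT)) := mul_le_mul hnψo_le h2 hnΩo0 hnψ0
      _ = 2 * t * l2 ΩT ΩT * l2 ψ ψ := by ring
  -- the coefficient `a = m / n`
  set n : ℝ := l2 ΩT ΩT with hn_def
  set m : ℝ := l2 ψT Ω with hm_def
  set a : ℝ := m / n with ha_def
  have hF1 : a * n = m := by
    rcases eq_or_ne n 0 with h0 | h0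
    · have hm2 : m ^ 2 ≤ 0 := by
        have := hm_bd
        rw [h0] at this
        simpa using this
      have hm0 : m = 0 := pow_eq_zero_iff two_ne_zero |>.mp (le_antisymm hm2 (sq_nonneg _))
      rw [h0, hm0, mul_zero]
    · rw [ha_def, div_mul_cancel₀ _ h0]
  have ham : a * m = a ^ 2 * n := by rw [← hF1]; ring
  have hF3 : a ^ 2 * n ≤ 2 * t * l2 ψ ψ := by
    rcases eq_or_ne n 0 with h0 | h0
    · rw [h0, mul_zero]; positivity
    · have hnpos : 0 < n := lt_of_le_of_ne hn0 (Ne.symm h0)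
      have : a ^ 2 * n * n ≤ 2 * t * l2 ψ ψ * n := by
        calc a ^ 2 * n * n = (a * n) ^ 2 := by ring
          _ = m ^ 2 := by rw [hF1]
          _ ≤ 2 * t * n * l2 ψ ψ := hm_bd
          _ = 2 * t * l2 ψ ψ * n := by ring
      exact le_of_mul_le_mul_right this hnpos
  have ha2o : a ^ 2 * l2 Ωo Ωo ≤ l2 ψ ψ := by
    have h1 : l2 Ωo Ωo ≤ t * (2 * n) := htail.trans (mul_le_mul_of_nonneg_left hΩ_le ht0)
    have h2 : a ^ 2 * l2 Ωo Ωo ≤ a ^ 2 * (t * (2 * n)) := mul_le_mul_of_nonneg_left h1 (sq_nonneg a)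
    nlinarith [h2, hF3, ht, ht0, hnψ0]
  -- the truncated, re-orthogonalised test function
  have hs : IsPhys ((-a) • ΩT) := hΩT.smul _
  refine ⟨ψT + (-a) • ΩT, hψT.add hs, ?_, ?_, ?_, ?_⟩
  · -- orthogonality to `Ω`
    rw [l2_add_left hψT hs hΩ, l2_smul_left, e_ΩTΩ]
    linarith [hF1]
  · -- support in the tube
    intro U hU
    simp [hψT_def, hΩT_def, if_pos hU]
  · -- norm
    have hexp : l2 (ψT + (-a) • ΩT) (ψT + (-a) • ΩT) = l2 ψT ψT - 2 * a * m + a ^ 2 * n := by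
      rw [l2_add_left hψT hs (hψT.add hs), l2_smul_left, l2_comm ψT (ψT + (-a) • ΩT), l2_comm ΩT (ψT + (-a) • ΩT),
        l2_add_left hψT hs hψT, l2_add_left hψT hs hΩT, l2_smul_left, l2_smul_left, l2_comm ΩT ψT, e_ψTΩT]
      ring
    rw [hexp]
    exact reorth_norm_arith hnψT_le ham hn0
  · -- energy
    have hlam : 0 ≤ topValue su2Rep L β := (topValue_su2Rep_pos L β).le
    -- split of `Q(ψ)`
    have hQψ : qform su2Rep β ψ ψ = qform su2Rep β ψT ψT + 2 * qform su2Rep β ψT ψo + qform su2Rep β ψo ψo := by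
      conv_lhs => rw [← hsplitψ]
      rw [qform_add_left β hψT hψo (hψT.add hψo), qform_add_right β hψT hψT hψo, qform_add_right β hψo hψT hψo,
        qform_su2Rep_comm β hψo hψT]
      ring
    -- expansion of `Q(ψ')`
    have hQψ' : qform su2Rep β (ψT + (-a) • ΩT) (ψT + (-a) • ΩT) =
        qform su2Rep β ψT ψT - 2 * a * qform su2Rep β ψT ΩT + a ^ 2 * qform su2Rep β ΩT ΩT := by
      rw [qform_add_left β hψT hs (hψT.add hs), qform_add_right β hψT hψT hs, qform_add_right β hs hψT hs,
        qform_smul_right β (-a) hψT hΩT, qform_smul_left, qform_smul_left, qform_smul_right β (-a) hΩT hΩT,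
        qform_su2Rep_comm β hΩT hψT]
      ring
    have hQΩT : 0 ≤ a ^ 2 * qform su2Rep β ΩT ΩT := mul_nonneg (sq_nonneg a) (qform_su2Rep_self_nonneg hβ hΩT)
    -- `⟨ψ_T, KΩ_T⟩ = λ₀ m − ⟨ψ_T, KΩ_o⟩`
    have hsplit2 : qform su2Rep β ψT ΩT = topValue su2Rep L β * m - qform su2Rep β ψT Ωo := by
      have h1 : qform su2Rep β ψT Ω = qform su2Rep β ψT ΩT + qform su2Rep β ψT Ωo := by
        rw [← qform_add_right β hψT hΩT hΩo, hsplitΩ]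
      have h2 : qform su2Rep β ψT Ω = topValue su2Rep L β * m := qform_groundState_right heig ψT
      linarith
    have hY : a * qform su2Rep β ψT ΩT = topValue su2Rep L β * (a * m) - a * qform su2Rep β ψT Ωo := by
      rw [hsplit2]; ring
    have ham' : topValue su2Rep L β * (a * m) = topValue su2Rep L β * (a ^ 2 * n) := by rw [ham]
    have hF3' : topValue su2Rep L β * (a ^ 2 * n) ≤ topValue su2Rep L β * (2 * t * l2 ψ ψ) :=
      mul_le_mul_of_nonneg_left hF3 hlam
    have hdlam : 0 ≤ δ * topValue su2Rep L β := mul_nonneg hδ hlam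
    -- the three kernel bounds
    have hX : qform su2Rep β ψT ψo ≤ δ * topValue su2Rep L β * l2 ψ ψ / 2 := by
      have h := (le_abs_self _).trans (hker ψT ψo hψT hψo hψo_s)
      rwa [hnψ] at h
    have hQo : qform su2Rep β ψo ψo ≤ δ * topValue su2Rep L β * l2 ψ ψ := by
      have h := (le_abs_self _).trans (hker ψo ψo hψo hψo hψo_s)
      have h' : δ * topValue su2Rep L β * l2 ψo ψo ≤ δ * topValue su2Rep L β * l2 ψ ψ :=
        mul_le_mul_of_nonneg_left hnψo_le hdlam
      linarith
    have hZ : -(a * qform su2Rep β ψT Ωo) ≤ δ * topValue su2Rep L β * l2 ψ ψ := by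
      have hsa : IsPhys (a • Ωo) := hΩo.smul a
      have hsupp : ∀ U, (a • Ωo) U ≠ 0 → η < wilsonAction su2Rep U := fun U hU =>
        hΩo_s U (fun h => hU (by simp [Pi.smul_apply, h]))
      have h := (neg_le_abs _).trans (hker ψT (a • Ωo) hψT hsa hsupp)
      have hl2a : l2 (a • Ωo) (a • Ωo) = a ^ 2 * l2 Ωo Ωo := by
        rw [l2_smul_left, l2_comm, l2_smul_left]; ring
      rw [qform_smul_right β a hψT hΩo, hl2a] at h
      have h1 : δ * topValue su2Rep L β * l2 ψT ψT ≤ δ * topValue su2Rep L β * l2 ψ ψ :=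
        mul_le_mul_of_nonneg_left hnψT_le hdlam
      have h2 : δ * topValue su2Rep L β * (a ^ 2 * l2 Ωo Ωo) ≤ δ * topValue su2Rep L β * l2 ψ ψ :=
        mul_le_mul_of_nonneg_left ha2o hdlam
      linarith
    rw [hQψ, hQψ']
    exact reorth_energy_arith hY ham' hF3' hQΩT hX hQo hZ

end Summit.QuantumFields.YangMills.Theorems.FemtoCutoffLadder

end
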